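import Summits.BirchSwinnertonDyer.Rank1Residual.WAll.ConjunctionDischarged
import Summits.BirchSwinnertonDyer.Rank1Residual.WAll.AltClosersGlue
import Summits.BirchSwinnertonDyer.Rank1Residual.Partition.CornersYanZhu
import Summits.BirchSwinnertonDyer.Rank1Residual.Partition.YanZhuImForm
import HarnessLib

/-!
# Rung W-ALL of ladder BSD (D-0120) — the kernel with ELEVEN named print facts: the
# Burungale–Castella–Skinner 2025 Cor. 1.3.1 binder DROPPED from the summit-bearing rung's
# hypothesis list BY NAME, through Yan–Zhu, J. Algebra 693 (2026) Thm. 5.11 in its printed (Im) form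
# (cell `bsd-litref`, tranche T2a, paper sub-dir `bcs25`, typer seat `bsd-litref-bcs25-ty`; a feeder
# object for cell `bsd-wall`, lane (2))

HONEST FRAMING (programme `BSD-LIT2PART-PROGRAMME-v1.md` §HONESTY, verbatim): «no tranche here
proves BSD; ARM L moves the LITERAL column of an r ≤ 1 census into the
kernel-proved-modulo-named-print column; ARM P changes what «named print» is worth.» And cell
`bsd-wall`'s own (`Rank1Residual/WAll/Target.lean`): W-ALL is OPEN; the files of this directory
PROVE only bookkeeping. THIS FILE TOO: theorems only — no definition, no `@[conjecture]`, no named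
fact is introduced, nothing is asserted about any curve, nothing is booked, no route file is
imported; every published theorem enters as one of the tree's existing named Literature facts BY
NAME and stays a hypothesis. What changes is the LIST of those hypotheses: one name fewer.

## What this file proves

`Rank1Residual/WAll/ConjunctionDischarged.lean` (seat `bsd-wall-ty-1`) gives rung W-ALL
(`Summit.BirchSwinnertonDyer.WAll`: `BSD(E,p)` for every `E/ℚ` of analytic rank `≤ 1` and every
prime `p`) from the closed list of twelve exclusion-class `Prop`s and TWELVE named published facts
— `hSk` Skinner 2016 Thm C · `hBCS` BCS25 Cor 1.3.1 · `hJSW` JSW17 Thm 1.2.1 · `hCGS` CGS25 Thm D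
· `hGV` Greenberg–Vatsal 2000 Thm 1.3 · `hGr` Greenberg 1999 · `hmodP` modularity with `c ∈ ℤ` ·
`hGZK` Gross–Zagier–Kolyvagin · `hCM` Rubin 1991 / Burungale–Flach 2024 · `hKob` Kobayashi 2013
Cor 1.4 · `hYZ` Yan–Zhu 2026 Thm 4.15 (special-case form) · `hLLT` Li–Liu–Tian 2024 Thm 1.1
(`hmod` derived from `hmodP`, Wuthrich 2014 Lemma 20 discharged).

Two tree theorems make the BCS binder redundant in that list:

* `Rank1Residual.RowC2.bcsCor131_of_yanZhuImForm` (`Partition/CornersYanZhu.lean`): the BCS25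
  Cor. 1.3.1 binder EXACTLY AS VENDORED (`BurungaleCastellaSkinner2025.cor131_padicValRat_bsd_rank_le_one`)
  is a consequence of the Yan–Zhu binder in its PRINTED (Im) form
  (`YanZhu2026.thm415_padicValRat_bsd_rank_le_one_of_bigIm`: every `p ≥ 3` good ordinary, `E[p]`
  irreducible, (Im), `ord_{s=1} L(E,s) ≤ 1`, no hypothesis on the conductor), with no further input
  (the two conclusions differ by `Ω_E > 0`, `Reg > 0` and Mazur's `p ∤ #E(ℚ)_tors` under (irr));
* `Rank1Residual.yanZhu_thm415_of_thm415_of_bigIm` (`Partition/YanZhuImForm.lean`, cell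
  `bsd-litref` sub-dir `yz26`): the special-case Yan–Zhu binder `hYZ` of `CornersAll` is a
  consequence of the same printed (Im) form (Serre; Skinner 2016 §2.5 — both kernel theorems).

Hence:

1. `wAll_of_conjunction_yanZhuImForm` / `wAll_of_exclusions_yanZhuImForm` /
   `wAll_iff_exclusions_yanZhuImForm` — **W-ALL from the closed list and ELEVEN named facts**:
   `hSk hJSW hCGS hGV hGr hmodP hGZK hCM hKob hYZ hLLT`, with `hYZ` now the PRINTED (Im) form and
   NO BCS binder; `wAllFormula_of_exclusions_yanZhuImForm` — the leading-term reading with the two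
   sign binders `hL0`, `hGZ` as in ty-1's file.
2. `Rank1Residual.WAll.wAll_of_leaves_yanZhuImForm` — seat `bsd-wall-ty-2`'s registry theorem
   `wAll_of_leaves` (`AltClosersGlue.lean`: W-ALL from the registered rung leaves) with the same
   eleven print binders in place of fourteen (`hBCS` dropped, `hmod` derived, `hW20` discharged).

WHAT THIS IS WORTH, EXACTLY (words of record, reading desk C4 of `pub-bsdpct`, bcs25 family:
ROUND C4-R4 01:26:08Z, C4-R4-ADD 02:13:27Z, C4-R4-ADD-2 02:28:15Z, C4-R4-ADD-4 02:48:07Z,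
2026-08-27): the BCS25 Cor. 1.3.1 binder is refereed print (IMRN 2025) typed VERBATIM ×2, but its
printed PROOF carries three non-refereed inputs on the census register's row D1 —
(1) `BCS25-IMC-equiv@BSTW` (Burungale–Skinner–Tian–Wan 2024 Part II Prop. 1.18-ord, refereed IN
CELL PASS-in-cell; Part I §5 = the `bstw24` N1 package, C4-R3 (γ) PASS-in-cell modulo PUB inputs at
`p ≥ 5`), (2) `Wan15-Thm3@Fuj06(unpublished)` (X. Wan 2015 Thm. 86 (3) freeness ← Fujiwara 2006,
never published; GAP(line) of record, every candidate mover blocked by the Gorenstein node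
`Wan15-Prop96-Gorenstein(g_θ)@Hida06(S)/Hida09-reading(⇐Fuj06-n.o.-CM)`), (3) `Hid04-density@Hi4
(to-appear)` — whereas Yan–Zhu's Thm. 5.11 (refereed, J. Algebra 693 (2026); statement A11 = print,
`yz26` reader 1 VERBATIM) carries, at `p ≥ 5`, component (1) ALONE (finding F-r1-3, two readers,
CONFIRMED at desk C4 ×2; its `p = 3` cells carry the separate flag `YZ26@3-BF-ERL-Ohta`). So in
the PROOF-INPUT ledger behind the kernel form of rung W-ALL, the unpublished [Fuj06] freeness and
the [Hid04] density gap LEAVE the dependency cone; nothing new enters (the (Im)-form binder was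
already the refereed statement behind `hYZ`). No census number moves here; flags, re-keys and
bookings are referee A's acts; typed ≠ proved ≠ endorsed; BSD is not proved by any of this.

References: `Rank1Residual/WAll/Target.lean`, `…/Conjunction.lean`, `…/ConjunctionDischarged.lean`
(seat `bsd-wall-ty-1`), `…/AltClosersGlue.lean` (seat `bsd-wall-ty-2`), `Partition/CornersYanZhu.lean`
(p488077), `Partition/YanZhuImForm.lean`, `Partition/CornersAll.lean`;
[cite: YanZhu2024MainConjNonCM, Thm. 4.15 (§4.6) = Cor. 1.4 = J. Algebra 693 Thm. 5.11, hypothesis (Im)];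
[cite: BurungaleCastellaSkinner2025, Cor. 1.3.1 (p. 4)]; [cite: Miller2011LMS, §1 and Def. 1.1].
-/

noncomputable section

open scoped Classical

open WeierstrassCurve Literature.NumberTheory.EllipticCurves
  Literature.NumberTheory.EllipticCurves.Rank1Residual
  Literature.NumberTheory.EllipticCurves.Rank1Residual.Typed
  Literature.NumberTheory.EllipticCurves.Wuthrich2014
  Literature.NumberTheory.EllipticCurves.ModularForms
open Summit.BirchSwinnertonDyer.Rank1Residual
open Summit.BirchSwinnertonDyer.BirchSwinnertonDyer.Rank1Residual (NonCMAtTwo BSDpOnClassX9)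

set_option autoImplicit false

namespace Summit.BirchSwinnertonDyer

/-! ### §1. W-ALL from the closed list and ELEVEN named facts (no BCS binder) -/

/-- **W-ALL FROM THE CONJUNCTION, ELEVEN named facts.** The twelve exclusion-class `Prop`s of the
closed list (row 1 = the reused leaf `NonCMAtTwo`) and eleven named published facts — Skinner 2016
Thm C, JSW17 Thm 1.2.1, CGS25 Thm D, Greenberg–Vatsal 2000 Thm 1.3, Greenberg 1999, modularity with
`c ∈ ℤ`, Gross–Zagier–Kolyvagin, Rubin 1991 / Burungale–Flach 2024, Kobayashi 2013 Cor 1.4, Yan–Zhu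
2026 Thm 5.11 / 4.15 IN ITS PRINTED (Im) FORM, Li–Liu–Tian 2024 Thm 1.1 — give `BSD(E,p)` for every
`E/ℚ` of analytic rank `≤ 1` and every prime `p`. The BCS25 Cor. 1.3.1 binder of
`wAll_of_conjunction_discharged` is fed `RowC2.bcsCor131_of_yanZhuImForm hYZ`, the special-case
Yan–Zhu binder `yanZhu_thm415_of_thm415_of_bigIm hYZ`. [folklore] -/
theorem wAll_of_conjunction_yanZhuImForm (h5 : NonCMAtTwo) (hAdd : WAllExclAdditive)
    (hM1 : WAllExclMultRankOne) (hX1 : WAllCornerX1) (hX2 : WAllCornerX2) (hX6 : WAllCornerX6r0)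
    (hX7 : WAllCornerX7) (hX8 : WAllCornerX8) (hX9 : WAllCornerX9) (hX10b : WAllCornerX10b)
    (hX11a : WAllCornerX11a) (hF : WAllCornerF)
    (hSk : Skinner2016.thmC_padicValRat_bsd_rank_zero)
    (hJSW : JetchevSkinnerWan2017.thm121_padicValRat_bsd_rank_one)
    (hCGS : CastellaGrossiSkinner2025.thmD_padicValRat_bsd_rank_le_one)
    (hGV : GreenbergVatsal2000.thm13_charIdeal_eq_of_gvPar) (hGr : greenberg_charValue_rankZero)
    (hmodP : nonempty_modularParametrizationData)
    (hGZK : rank_eq_analyticRank_of_analyticRank_le_one)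
    (hCM : bsdTriple_of_hasCM_of_L_one_ne_zero) (hKob : Kobayashi2013.cor14_bsdp_of_cm_rank_one)
    (hYZ : YanZhu2026.thm415_padicValRat_bsd_rank_le_one_of_bigIm)
    (hLLT : LiLiuTian2024.thm11_bsdp_of_cm_rank_one) : WAll :=
  wAll_of_conjunction_discharged h5 hAdd hM1 hX1 hX2 hX6 hX7 hX8 hX9 hX10b hX11a hF hSk
    (RowC2.bcsCor131_of_yanZhuImForm hYZ) hJSW hCGS hGV hGr hmodP hGZK hCM hKob
    (yanZhu_thm415_of_thm415_of_bigIm hYZ) hLLT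

/-- **W-ALL from the packaged conjunction** `WAllExclusions`, ELEVEN named facts (no BCS binder;
Yan–Zhu in printed (Im) form). [folklore] -/
theorem wAll_of_exclusions_yanZhuImForm (h : WAllExclusions)
    (hSk : Skinner2016.thmC_padicValRat_bsd_rank_zero)
    (hJSW : JetchevSkinnerWan2017.thm121_padicValRat_bsd_rank_one)
    (hCGS : CastellaGrossiSkinner2025.thmD_padicValRat_bsd_rank_le_one)
    (hGV : GreenbergVatsal2000.thm13_charIdeal_eq_of_gvPar) (hGr : greenberg_charValue_rankZero)
    (hmodP : nonempty_modularParametrizationData)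
    (hGZK : rank_eq_analyticRank_of_analyticRank_le_one)
    (hCM : bsdTriple_of_hasCM_of_L_one_ne_zero) (hKob : Kobayashi2013.cor14_bsdp_of_cm_rank_one)
    (hYZ : YanZhu2026.thm415_padicValRat_bsd_rank_le_one_of_bigIm)
    (hLLT : LiLiuTian2024.thm11_bsdp_of_cm_rank_one) : WAll :=
  wAll_of_exclusions_discharged h hSk (RowC2.bcsCor131_of_yanZhuImForm hYZ) hJSW hCGS hGV hGr hmodP
    hGZK hCM hKob (yanZhu_thm415_of_thm415_of_bigIm hYZ) hLLT

/-- **The closed list is exactly W-ALL modulo ELEVEN named facts** (no BCS binder; Yan–Zhu in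
printed (Im) form). [folklore] -/
theorem wAll_iff_exclusions_yanZhuImForm (hSk : Skinner2016.thmC_padicValRat_bsd_rank_zero)
    (hJSW : JetchevSkinnerWan2017.thm121_padicValRat_bsd_rank_one)
    (hCGS : CastellaGrossiSkinner2025.thmD_padicValRat_bsd_rank_le_one)
    (hGV : GreenbergVatsal2000.thm13_charIdeal_eq_of_gvPar) (hGr : greenberg_charValue_rankZero)
    (hmodP : nonempty_modularParametrizationData)
    (hGZK : rank_eq_analyticRank_of_analyticRank_le_one)
    (hCM : bsdTriple_of_hasCM_of_L_one_ne_zero) (hKob : Kobayashi2013.cor14_bsdp_of_cm_rank_one)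
    (hYZ : YanZhu2026.thm415_padicValRat_bsd_rank_le_one_of_bigIm)
    (hLLT : LiLiuTian2024.thm11_bsdp_of_cm_rank_one) : WAll ↔ WAllExclusions :=
  ⟨wAllExclusions_of_wAll, fun h ↦ wAll_of_exclusions_yanZhuImForm h hSk hJSW hCGS hGV hGr hmodP hGZK
    hCM hKob hYZ hLLT⟩

/-- **The leading-term form of rung W-ALL from the closed list**, ELEVEN named facts (no BCS
binder; Yan–Zhu in printed (Im) form) and the two sign binders `hL0` (`L(E,1) ≥ 0`) and `hGZ`
(Gross–Zagier, rank one). [cite: Miller2011LMS, §1 and Def. 1.1] -/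
theorem wAllFormula_of_exclusions_yanZhuImForm (h : WAllExclusions)
    (hSk : Skinner2016.thmC_padicValRat_bsd_rank_zero)
    (hJSW : JetchevSkinnerWan2017.thm121_padicValRat_bsd_rank_one)
    (hCGS : CastellaGrossiSkinner2025.thmD_padicValRat_bsd_rank_le_one)
    (hGV : GreenbergVatsal2000.thm13_charIdeal_eq_of_gvPar) (hGr : greenberg_charValue_rankZero)
    (hmodP : nonempty_modularParametrizationData)
    (hGZK : rank_eq_analyticRank_of_analyticRank_le_one)
    (hCM : bsdTriple_of_hasCM_of_L_one_ne_zero) (hKob : Kobayashi2013.cor14_bsdp_of_cm_rank_one)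
    (hYZ : YanZhu2026.thm415_padicValRat_bsd_rank_le_one_of_bigIm)
    (hLLT : LiLiuTian2024.thm11_bsdp_of_cm_rank_one)
    (hL0 : re_entireLFunction_one_nonneg) (hGZ : gross_zagier_rank_one_rat) : WAllFormula :=
  wAllFormula_of_wAll_discharged hmodP hL0 hGZ
    (wAll_of_exclusions_yanZhuImForm h hSk hJSW hCGS hGV hGr hmodP hGZK hCM hKob hYZ hLLT)

end Summit.BirchSwinnertonDyer

namespace Summit.BirchSwinnertonDyer.Rank1Residual.WAll

open Summit.BirchSwinnertonDyer

/-! ### §2. W-ALL from the registered leaves, ELEVEN print binders -/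

/-- **W-ALL FROM THE REGISTERED LEAVES, ELEVEN print binders** (`wAll_of_leaves` of
`AltClosersGlue.lean` with `hBCS` dropped through `RowC2.bcsCor131_of_yanZhuImForm`, `hYZ` taken in
its printed (Im) form, `hmod` derived from `hmodP`
(`hasEntireLFunction_rat_of_nonempty_modularParametrizationData`) and Wuthrich 2014 Lemma 20
discharged (`…_holds`)): the rung, kernel-tracked at sub-class granularity — every hypothesis is a
registered rung leaf, a typed cell target, one of the three named residual statements (`hUp`,
`WAllCornerFTwo`, `WAllCornerFRamified`), `sha_dvd_analyticSha`, or one of ELEVEN named published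
facts of the tree. [folklore] -/
theorem wAll_of_leaves_yanZhuImForm (h5 : NonCMAtTwo)
    (hK1 : Additive.AdditiveOrdinaryLowerHalf)
    (hUp : ∀ (W : WeierstrassCurve ℚ) [W.IsElliptic] [W.IsGloballyMinimal] (p : ℕ) [Fact p.Prime],
      W.analyticRank ≤ 1 → Additive.N10.Locus W p → MissingUpperBoundAt W p)
    (hK8 : Additive.O5SharpGss) (hK9t : Additive.O5SharpTprime) (hK9w : Additive.O6Sharp)
    (hK2a : X11b.MultiplicativeRankOne) (hK2b : X11b.MultiplicativeRankOneAtThree)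
    (hK5 : Eisenstein.EisensteinPrimes) (hK3 : Supersingular.SignedSupersingular)
    (hK6 : BSDpOnClassX9) (hX10b : X10.BSDpOnClassX10b) (hX11a : X11a.Target)
    (hIn : X12.CMInertBad) (hF2 : WAllCornerFTwo) (hFr : WAllCornerFRamified)
    (hW : sha_dvd_analyticSha)
    -- eleven of the fourteen print binders of `CornersAll` (`hBCS` dropped, `hmod` derived,
    -- `hW20` discharged), `hYZ` in the printed (Im) form
    (hSk : Skinner2016.thmC_padicValRat_bsd_rank_zero)
    (hJSW : JetchevSkinnerWan2017.thm121_padicValRat_bsd_rank_one)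
    (hCGS : CastellaGrossiSkinner2025.thmD_padicValRat_bsd_rank_le_one)
    (hGV : GreenbergVatsal2000.thm13_charIdeal_eq_of_gvPar) (hGr : greenberg_charValue_rankZero)
    (hmodP : nonempty_modularParametrizationData)
    (hGZK : rank_eq_analyticRank_of_analyticRank_le_one)
    (hCM : bsdTriple_of_hasCM_of_L_one_ne_zero) (hKob : Kobayashi2013.cor14_bsdp_of_cm_rank_one)
    (hYZ : YanZhu2026.thm415_padicValRat_bsd_rank_le_one_of_bigIm)
    (hLLT : LiLiuTian2024.thm11_bsdp_of_cm_rank_one) : WAll :=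
  wAll_of_exclusions_yanZhuImForm
    (wAllExclusions_of_leaves h5 hK1 hUp hK8 hK9t hK9w hK2a hK2b hK5 hK3 hK6 hX10b hX11a hIn hF2 hFr
      hW (X2.ClassClosureEntireFree.hasEntireLFunction_rat_of_nonempty_modularParametrizationData hmodP)
      hGZK hLLT)
    hSk hJSW hCGS hGV hGr hmodP hGZK hCM hKob hYZ hLLT

end Summit.BirchSwinnertonDyer.Rank1Residual.WAll

end
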